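import Summits.ResolutionOfSingularities.ResolutionOfSingularities.Theorems.PurelyInseparableDim4BandShade
import Summits.ResolutionOfSingularities.ResolutionOfSingularities.Theorems.PurelyInseparableDim4FreeTailLemma
import Summits.ResolutionOfSingularities.ResolutionOfSingularities.Theorems.PurelyInseparableDim4FreeTail
import HarnessLib
import HarnessLib.Audit.Tags

/-!
# Purely inseparable four-folds — K2(p), SLICE A IS EMPTY: no isolated above-floor `Step0 p` chain has
# constant shade `d ≥ p` (every prime `p`; idea-4's phase «d ≥ p», card I-4-2 (L≥))

[OURS · counted 0 · cell `res-dim4-pi` · seat res-dim4-p-7 g2 · K2(p) lane (holder res-dim4-p-12 g2, desk WORD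
#66 (2)); hand proof res-dim4-idea-4 (card I-4-2 (L≥)); free-tail theorem res-dim4-p-5
(`FreeTailProof.noIsolatedFreeTailAt_self`).]  Nothing here proves K2(p) = `RidgeBudget.NoAboveFloorTrap p p`
(slices B / C: constant shade `d < p` stay OPEN for `p ≥ 5`), `NoIsolatedTrap p p`, or resolution of
singularities in dimension ≥ 4 / characteristic `p`.

THE LEDGER ARGUMENT.  Along an isolated `Step0 p` chain avoiding the floor, `N_k := ord₀ F_k ∈ (p, 2p − 2]`
(`IsolatedBand.isolated_chain_band`).  If the shade `N_k − |r_k|` is a constant `d ≥ 1` then `N_k = d + |r_k|`,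
and the boundary bookkeeping of a point step in chart `j` at the translated point `b` (`CentreBlowup.newMult`:
`r′ = (r|_{b = 0}).update j (N − p)`) gives `|r_{k+1}| = (N_k − p) + σ_k`, `σ_k := Σ_{i ≠ j_k, b_k(i) = 0} r_k(i)`
(the kept old multiplicities); hence **`N_{k+1} − N_k = (d − p) + σ_k`**, which is `≥ σ_k ≥ 0` once `d ≥ p`.
A SATELLITE step `k + 1` (`FreeTail.IsSatellite`: another chart, the previous exceptional coordinate not
translated) keeps the previous new component, of multiplicity `N_k − p ≥ 1`, so `σ_{k+1} ≥ 1` and `N` rises.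
By the FREE-TAIL THEOREM (`FreeTailProof.noIsolatedFreeTailAt_self`, in its positive form
`FreeTail.SatelliteRecurrenceAt`) satellite steps recur along every isolated chain — so `N` is unbounded,
contradicting `N ≤ 2p − 2`.  No `x^{r₀} ∣ F₀` normalisation, no bound `d ≤ 2p − 2`, no polar-kernel letter is needed.

* `step_r_univ'` — the boundary of a point step, `r′ = (r|_{b=0}).update j (o − q)` (no divisibility hypothesis);
* `no_constantShadeTrap_of_le_shade` — the theorem (natural shade `d`, `p ≤ d`);
* `no_constantShadeTrap_of_le_shade'` — the same with an `ℕ∞`-valued constant shade `(p : ℕ∞) ≤ d`;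
* `no_locatedTrap_sliceA` — res-dim4-p-12 g2's located-trap shape (`x^{r₀} ∣ F₀`, window, any extra letter)
  restricted to `p ≤ d` is empty;
* `noAboveFloorTrap_iff_noLowShadeTrap` — **K2(p) ⟺ no constant-shade trap with `d < p`** (every prime).

bears_on: LADDER-RESOLUTION:D157-DOOR2 (res-dim4-pi · K2(p) · slice A).  Supports
stmt-ResolutionOfSingularities-16155 (helper).
-/

set_option linter.dupNamespace false -- mandated namespace of this single-conjunct summit

noncomputable section

namespace Summit.ResolutionOfSingularities.ResolutionOfSingularities.Theorems.PIDim4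

namespace ResCone

open MvPolynomial Finset
open Literature.AlgebraicGeometry.Resolution
open Literature.AlgebraicGeometry.Resolution.CentreBlowup
open Literature.AlgebraicGeometry.Resolution.Hauser2010

variable {K : Type} [Field K]

/-- **The new boundary of a point step** (no divisibility hypothesis): `r′ = (r|_{b = 0}).update j (o − q)` for
`ord₀ F = o` — the new component `{y_j = 0}` gets `o − q`, a translated coordinate loses its component.
[cite: HauserPerlega2019PRIMS, §2 (transform D' of D)] -/
theorem step_r_univ' [DecidableEq K] (q : ℕ) (j : Fin 4) (b : Fin 4 → K) (s : State K) {o : ℕ}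
    (ho : ordZero s.F = o) :
    (CentreBlowup.step q Finset.univ j b s).r = (s.r.filter (fun i => b i = 0)).update j (o - q) := by
  show CentreBlowup.newMult q Finset.univ j b s = _
  unfold CentreBlowup.newMult
  rw [ordAlong_univ, ho, ENat.toNat_coe]

/-- **K2(p), SLICE A IS EMPTY** (idea-4 (L≥), every prime `p`): over a field of characteristic `p` there is no
infinite `Step0 p` chain of ISOLATED states, all off the floor (`ord₀ ≠ p`), of CONSTANT natural shade `d ≥ p`.
(Band `N ≤ 2p − 2`; `N_{k+1} − N_k = (d − p) + σ_k ≥ 0`; a satellite step adds `≥ 1`; satellites recur by the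
free-tail theorem.) [OURS · K2(p) phase d ≥ p] [cite: HauserPerlega2019PRIMS, §2 (transform D' of D)] -/
theorem no_constantShadeTrap_of_le_shade (p : ℕ) [hp : Fact p.Prime] (K : Type) [Field K] [CharP K p]
    [DecidableEq K] :
    ¬ ∃ (c : ℕ → State K) (d : ℕ), p ≤ d ∧
      ∀ k, IsIsolated p (c k).F ∧ Step0 p (c k) (c (k + 1)) ∧ ordZero (c k).F ≠ p ∧
        (c k).shade = (d : ℕ∞) := by
  rintro ⟨c, d, hpd, hc⟩
  have hp2 : 2 ≤ p := hp.out.two_le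
  have hc2 : ∀ k, IsIsolated p (c k).F ∧ Step0 p (c k) (c (k + 1)) := fun k => ⟨(hc k).1, (hc k).2.1⟩
  obtain ⟨j, b, hw⟩ := FreeTail.exists_witnesses (K := K) (fun k => (hc k).2.1)
  -- the orders `N_k = o k ∈ (p, 2p − 2]`
  choose o ho hpo ho2 using BandShade.exists_ordZero_eq p hc2
  have hpo' : ∀ k, p < o k := fun k =>
    lt_of_le_of_ne (hpo k) fun h => (hc k).2.2.1 (by rw [ho k, ← h])
  -- constant shade: `N_k = d + |r_k|`
  have hN : ∀ k, o k = d + (c k).r.degree := by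
    intro k
    have hsh := (hc k).2.2.2
    rw [BandShade.shade_eq_coe (ho k)] at hsh
    have h : o k - (c k).r.degree = d := by exact_mod_cast hsh
    omega
  -- the boundary bookkeeping of the step `k → k + 1`
  have hr : ∀ k, (c (k + 1)).r = ((c k).r.filter (fun i => b k i = 0)).update (j k) (o k - p) := by
    intro k
    obtain ⟨-, -, -, -, hck⟩ := hw k
    rw [hck]
    exact step_r_univ' p (j k) (b k) (c k) (ho k)
  have hdeg : ∀ k, (c (k + 1)).r.degree =
      (o k - p) + ∑ i ∈ Finset.univ.erase (j k), (if b k i = 0 then (c k).r i else 0) := by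
    intro k
    rw [hr k, Finsupp.degree_eq_sum, ← Finset.add_sum_erase _ _ (Finset.mem_univ (j k))]
    congr 1
    · rw [Finsupp.update_apply, if_pos rfl]
    · refine Finset.sum_congr rfl fun i hi => ?_
      rw [Finsupp.update_apply, if_neg (Finset.ne_of_mem_erase hi), Finsupp.filter_apply]
  -- `N_{k+1} ≥ N_k + σ_k`
  have hstep : ∀ k, o k + ∑ i ∈ Finset.univ.erase (j k), (if b k i = 0 then (c k).r i else 0) ≤ o (k + 1) := by
    intro k
    have h1 := hN (k + 1)
    rw [hdeg k] at h1
    have h2 := hpo' k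
    omega
  have hmono : Monotone o := monotone_nat_of_le_succ fun k => le_trans (Nat.le_add_right _ _) (hstep k)
  -- a satellite step raises `N` by at least one
  have hsat : ∀ k, FreeTail.IsSatellite j b k → o (k + 1) + 1 ≤ o (k + 1 + 1) := by
    rintro k ⟨hjk, hbk⟩
    have hrj : (c (k + 1)).r (j k) = o k - p := by
      rw [hr k, Finsupp.update_apply, if_pos rfl]
    have hmem : j k ∈ Finset.univ.erase (j (k + 1)) :=
      Finset.mem_erase.mpr ⟨fun h => hjk h.symm, Finset.mem_univ _⟩
    have hle : (if b (k + 1) (j k) = 0 then (c (k + 1)).r (j k) else 0) ≤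
        ∑ i ∈ Finset.univ.erase (j (k + 1)), (if b (k + 1) i = 0 then (c (k + 1)).r i else 0) :=
      Finset.single_le_sum (f := fun i => if b (k + 1) i = 0 then (c (k + 1)).r i else 0)
        (fun i _ => Nat.zero_le _) hmem
    rw [if_pos hbk, hrj] at hle
    have h1 := hstep (k + 1)
    have h2 := hpo' k
    omega
  -- satellites recur (the free-tail theorem, positive form)
  have hrec : ∀ k₀ : ℕ, ∃ k, k₀ ≤ k ∧ FreeTail.IsSatellite j b k :=
    (FreeTail.satelliteRecurrenceAt_iff_noIsolatedFreeTailAt p p).mpr (FreeTailProof.noIsolatedFreeTailAt_self p)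
      K c j b hw (fun k => (hc k).1)
  -- so `N` is unbounded
  have hgrow : ∀ m : ℕ, ∃ k, o 0 + m ≤ o k := by
    intro m
    induction m with
    | zero => exact ⟨0, by omega⟩
    | succ m ih =>
      obtain ⟨k, hk⟩ := ih
      obtain ⟨k', hk', hs⟩ := hrec k
      refine ⟨k' + 1 + 1, ?_⟩
      have h1 := hsat k' hs
      have h2 := hmono (show k ≤ k' + 1 by omega)
      omega
  obtain ⟨k, hk⟩ := hgrow (2 * p)
  have h1 := ho2 k
  have h2 := hpo 0
  omega

/-- **Slice A, `ℕ∞` form**: no isolated above-floor `Step0 p` chain has a constant shade `d` with `(p : ℕ∞) ≤ d`.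
[OURS · K2(p) phase d ≥ p] [cite: HauserPerlega2019PRIMS, §2 (transform D' of D)] -/
theorem no_constantShadeTrap_of_le_shade' (p : ℕ) [hp : Fact p.Prime] (K : Type) [Field K] [CharP K p]
    [DecidableEq K] :
    ¬ ∃ (c : ℕ → State K) (d : ℕ∞), (p : ℕ∞) ≤ d ∧
      ∀ k, IsIsolated p (c k).F ∧ Step0 p (c k) (c (k + 1)) ∧ ordZero (c k).F ≠ p ∧ (c k).shade = d := by
  rintro ⟨c, d, hpd, hc⟩
  have hc2 : ∀ k, IsIsolated p (c k).F ∧ Step0 p (c k) (c (k + 1)) := fun k => ⟨(hc k).1, (hc k).2.1⟩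
  obtain ⟨o, ho, -, -⟩ := BandShade.exists_ordZero_eq p hc2 0
  -- the constant shade is a natural number
  have hd : d = ((o - (c 0).r.degree : ℕ) : ℕ∞) := by
    rw [← (hc 0).2.2.2, BandShade.shade_eq_coe ho]
  refine no_constantShadeTrap_of_le_shade p K ⟨c, o - (c 0).r.degree, ?_, fun k => ?_⟩
  · rw [hd] at hpd
    exact_mod_cast hpd
  · exact ⟨(hc k).1, (hc k).2.1, (hc k).2.2.1, hd ▸ (hc k).2.2.2⟩

/-- **res-dim4-p-12 g2's LOCATED-TRAP shape restricted to `p ≤ d` is empty** (any extra hypotheses — the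
normalisation `x^{r₀} ∣ F₀`, a shade window, a constant polar-kernel letter `P k` — only weaken the claim):
K2(p) is thereby reduced to the slices of constant shade `d < p`. [OURS · K2(p) phase d ≥ p]
[cite: HauserPerlega2019PRIMS, §2 (transform D' of D)] -/
theorem no_locatedTrap_sliceA (p : ℕ) [hp : Fact p.Prime] (K : Type) [Field K] [CharP K p] [DecidableEq K]
    (P : State K → Prop) :
    ¬ ∃ (c : ℕ → State K) (d : ℕ), p ≤ d ∧ (∀ e' ∈ (c 0).F.support, (c 0).r ≤ e') ∧
      ∀ k, IsIsolated p (c k).F ∧ Step0 p (c k) (c (k + 1)) ∧ ordZero (c k).F ≠ p ∧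
        (c k).shade = (d : ℕ∞) ∧ P (c k) := by
  rintro ⟨c, d, hpd, -, hc⟩
  exact no_constantShadeTrap_of_le_shade p K
    ⟨c, d, hpd, fun k => ⟨(hc k).1, (hc k).2.1, (hc k).2.2.1, (hc k).2.2.2.1⟩⟩

/-- **K2(p) ⟺ NO LOW-SHADE TRAP** (every prime `p`): `RidgeBudget.NoAboveFloorTrap p p` holds iff over every field
of characteristic `p` there is no isolated above-floor `Step0 p` chain with `x^{r₀} ∣ F₀` and CONSTANT natural shade
`d < p` — res-dim4-p-12 g2's «K2(p) ⟺ BCP(p)» (`BandShade.noAboveFloorTrap_iff_noConstantShadeTrap`) with the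
phase `d ≥ p` removed by `no_constantShadeTrap_of_le_shade`.  At `p = 5` the residue is `d ∈ {0, …, 4}` (and
`d = 0` is `…ResConeShadeZero`'s). [OURS · K2(p) located reduction] [cite: HauserPerlega2019PRIMS, §2 (transform D' of D)] -/
theorem noAboveFloorTrap_iff_noLowShadeTrap (p : ℕ) [hp : Fact p.Prime] :
    RidgeBudget.NoAboveFloorTrap p p ↔ ∀ (K : Type) [Field K] [CharP K p] [DecidableEq K],
      ¬ ∃ (c : ℕ → State K) (d : ℕ), d < p ∧ (∀ e ∈ (c 0).F.support, (c 0).r ≤ e) ∧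
        ∀ k, IsIsolated p (c k).F ∧ Step0 p (c k) (c (k + 1)) ∧ ordZero (c k).F ≠ p ∧
          (c k).shade = (d : ℕ∞) := by
  rw [BandShade.noAboveFloorTrap_iff_noConstantShadeTrap]
  constructor
  · intro h K _ _ _
    rintro ⟨c, d, -, hr0, hc⟩
    exact h K ⟨c, (d : ℕ∞), hr0, hc⟩
  · intro h K _ _ _
    rintro ⟨c, d, hr0, hc⟩
    have hc2 : ∀ k, IsIsolated p (c k).F ∧ Step0 p (c k) (c (k + 1)) := fun k => ⟨(hc k).1, (hc k).2.1⟩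
    obtain ⟨o, ho, -, -⟩ := BandShade.exists_ordZero_eq p hc2 0
    -- the constant shade is a natural number `d'`
    have hd : d = ((o - (c 0).r.degree : ℕ) : ℕ∞) := by
      rw [← (hc 0).2.2.2, BandShade.shade_eq_coe ho]
    by_cases hlt : o - (c 0).r.degree < p
    · exact h K ⟨c, o - (c 0).r.degree, hlt, hr0, fun k => hd ▸ hc k⟩
    · exact no_constantShadeTrap_of_le_shade p K
        ⟨c, o - (c 0).r.degree, not_lt.mp hlt, fun k => hd ▸ hc k⟩

end ResCone

end Summit.ResolutionOfSingularities.ResolutionOfSingularities.Theorems.PIDim4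

end
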